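import Summits.Ventures.PercRepro.LemmaBPlusK5Def

/-!
# Faces of `K₅`: kernel slices 36 … 39 (part J)

Each theorem is one `decide +kernel` at default heartbeats (≈ 55 s: the 1024-row table of the marking
plus ≤ 22 000 face points in sub-mask loops); generated by `tools/gen_k5.py`.
-/

namespace PercRepro

namespace Examples

open MultiGraph

/-- Slice 36: joins `u ∈ [966, 979)` of the faces of `K₅` (20169 face points). -/
theorem k5_slice_36 : k5.FacesSRange ![0, 1, 2, 3] 966 979 := by decide +kernel

/-- Slice 37: joins `u ∈ [979, 987)` of the faces of `K₅` (18954 face points). -/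
theorem k5_slice_37 : k5.FacesSRange ![0, 1, 2, 3] 979 987 := by decide +kernel

/-- Slice 38: joins `u ∈ [987, 991)` of the faces of `K₅` (21870 face points). -/
theorem k5_slice_38 : k5.FacesSRange ![0, 1, 2, 3] 987 991 := by decide +kernel

/-- Slice 39: joins `u ∈ [991, 995)` of the faces of `K₅` (21384 face points). -/
theorem k5_slice_39 : k5.FacesSRange ![0, 1, 2, 3] 991 995 := by decide +kernel

end Examples

end PercRepro
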